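import Literature.AlgebraicGeometry.Resolution.MaximalContactConeCriterion
import Literature.AlgebraicGeometry.Resolution.CoefficientIdeals
import HarnessLib

/-!
# Tame at level 0, wild at level 1: the coefficient ideal of `(z² + x^p, 2)` on its maximal-contact hypersurface is `(x^p)`

Topic: `Literature/AlgebraicGeometry/Resolution`. Bierstone–Grigoriev–Milman–Włodarczyk 2011,
§3.9 (Example 3.9.1, Def. 3.9.2: the coefficient ideal `𝒞(𝓘, μ) = Σ_{i<μ} (𝒟ⁱ𝓘)^{μ!/(μ−i)}`, so
`𝒞(𝓘, 2) = 𝓘 + 𝒟(𝓘)²` with marking `2`), §8 Thm. 8.0.4 ("as long as all multiplicities stay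
`< p`"); Kollár 2007, 3.104 Step 2.2 and Aside 3.57. The smallest instance of the phenomenon
"wild data reappear one level down" for the characteristic-zero induction run in characteristic
`p ≥ 3`:

  `f = z² + x^p ∈ K[x, z]`, `(f, 2)`: order `2 < p` — TAME at level 0; `𝒟((f)) = (z, x^p)`
  contains the order-one element `z`, so `z = 0` is a hypersurface of maximal contact
  (Kollár's `MC = 𝒟^{2−1}`); the coefficient ideal is `(f) + 𝒟((f))² = (z², x^p)`, and its
  restriction to `z = 0` is `(x^p)` with marking `2!= 2`: at the origin its order is `p`, its
  initial form `x^p` is WILD (all linear Hasse–Schmidt derivatives vanish,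
  `forall_hasseDeriv_X_pow_eq_zero_iff`), and the derivation-based maximal contact ideal of the
  next step is blind (`𝒟^j((x^p)) ⊆ 𝔪²` for all `j`, `derivIdealIter_span_X_pow_le_idealOfVars_sq`).

So the orders met at level 1 are not bounded by any function of the level-0 order `b = 2` (here
they equal `p = deg f`): a threshold "`p > C`" for the whole induction must depend on the degree
of the input (BGMW's `M(d, n, l)`, Lemma 8.0.3), in accordance with `CoefficientIdealFactorialOrder.lean`
(orders `≥ b!` over the cosupport) which it complements (orders unbounded above).

* `derivIdeal_span_singleton` — `𝒟((f)) = (f) + (∂f/∂x_i : i)` on a polynomial ring (any `f`);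
* `derivIdeal_span_tameWild`, `X_one_mem_derivIdeal_span_tameWild` — `𝒟((z² + x^p)) = (z, x^p) ∋ z`;
* `coeffIdealTwo_span_tameWild` — `(f) + 𝒟((f))² = (z², x^p)`;
* `map_killZ_coeffIdealTwo_span_tameWild` — its image under `z ↦ 0` is `(x^p)`;
* `nextLevel_wild_tameWild` — the level-1 ideal `(x^p)` has order `p > 2` at the origin, is wild, and
  is derivation-blind (`𝒟^j ⊆ 𝔪²`), although `2 < p`;
* (v2) `markedSum_pair_fst/snd`, `coeffIdeal_two` (`𝒞(𝓘, 2) = (𝓘 + 𝒟(𝓘)², 2)` for the tree's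
  `coeffIdeal`), `coeffIdeal_span_tameWild` (`coeffIdeal K (f) 2 = ((z², x^p), 2)`).

## Sources

* E. Bierstone, D. Grigoriev, P. Milman, J. Włodarczyk, arXiv:1206.3090: §3.9 Example 3.9.1,
  Def. 3.9.2, Lemma 8.0.3, Thm. 8.0.4. [BierstoneGrigorievMilmanWlodarczyk2011]
* J. Kollár, *Lectures on Resolution of Singularities* (2007): 3.104 Step 2.2, Aside 3.57.
  [Kollar2007]
-/

noncomputable section

open MvPolynomial
open scoped BigOperators

namespace Literature.AlgebraicGeometry.Resolution

/-! ## `𝒟` of a principal ideal in a polynomial ring -/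

section Principal

variable (R : Type*) [CommRing R] {σ : Type*} [Fintype σ]

/-- **`𝒟((f)) = (f) + (∂f/∂x_i : i)`** on `R[x_i : i ∈ σ]` (`σ` finite): the derivative ideal of a
principal ideal (BGMW §3.5: "`𝒟(𝓘)` is … defined locally by generators `f_j` of `𝓘` and all their
partial derivatives"; `δ(af) = a δf + f δa`, `δ = Σ δ(x_i) ∂_i`).
[cite: BierstoneGrigorievMilmanWlodarczyk2011, §3.5 after Def. 3.5.1] -/
theorem derivIdeal_span_singleton (f : MvPolynomial σ R) :
    derivIdeal R (Ideal.span {f}) = Ideal.span {f} ⊔ Ideal.span (Set.range fun i => pderiv i f) := by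
  apply le_antisymm
  · refine (derivIdeal_le_iff R).mpr ⟨le_sup_left, fun δ g hg => ?_⟩
    obtain ⟨a, rfl⟩ := Ideal.mem_span_singleton'.mp hg
    rw [Derivation.leibniz, smul_eq_mul, smul_eq_mul]
    refine Ideal.add_mem _ ?_ (Ideal.mem_sup_left (Ideal.mul_mem_right _ _ (Ideal.mem_span_singleton_self f)))
    refine Ideal.mem_sup_right (Ideal.mul_mem_left _ _ ?_)
    rw [MvPolynomial.derivation_apply_eq_sum]
    exact Ideal.sum_mem _ fun i _ => Ideal.mul_mem_left _ _ (Ideal.subset_span ⟨i, rfl⟩)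
  · refine sup_le (le_derivIdeal R _) (Ideal.span_le.mpr ?_)
    rintro _ ⟨i, rfl⟩
    exact pderiv_mem_derivIdeal R i (Ideal.mem_span_singleton_self f)

end Principal

/-! ## The example `f = z² + x^p` in characteristic `p ≥ 3` -/

section Example

variable (K : Type*) [Field K] (p : ℕ) [hp : Fact p.Prime] [CharP K p]

omit hp in
/-- `∂f/∂x = p x^{p−1} = 0` in characteristic `p`. [folklore] -/
private theorem pderiv_zero_tameWild :
    pderiv 0 (X 1 ^ 2 + X 0 ^ p : MvPolynomial (Fin 2) K) = 0 := by
  rw [map_add, (pderiv 0).leibniz_pow, (pderiv 0).leibniz_pow,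
    pderiv_X_of_ne (show (1 : Fin 2) ≠ 0 by decide), pderiv_X_self, smul_zero, smul_zero, zero_add,
    smul_eq_mul, mul_one, nsmul_eq_mul, CharP.cast_eq_zero, zero_mul]

omit hp [CharP K p] in
/-- `∂f/∂z = 2z`. [folklore] -/
private theorem pderiv_one_tameWild :
    pderiv 1 (X 1 ^ 2 + X 0 ^ p : MvPolynomial (Fin 2) K) = 2 * X 1 := by
  rw [map_add, (pderiv 1).leibniz_pow, (pderiv 1).leibniz_pow, pderiv_X_self,
    pderiv_X_of_ne (show (0 : Fin 2) ≠ 1 by decide), smul_zero, smul_zero, add_zero,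
    show (2 : ℕ) - 1 = 1 from rfl, pow_one, smul_eq_mul, mul_one, nsmul_eq_mul, Nat.cast_ofNat]

omit hp in
/-- `2 ≠ 0` in `K` of characteristic `p ≥ 3`. [folklore] -/
private theorem two_ne_zero_of_three_le (hp3 : 3 ≤ p) : (2 : K) ≠ 0 := by
  rw [show (2 : K) = ((2 : ℕ) : K) by norm_num, Ne, CharP.cast_eq_zero_iff K p]
  intro h
  have := Nat.le_of_dvd two_pos h
  omega

omit hp in
/-- `z = 2⁻¹ · (2 z)` in `K[x, z]`, `p ≥ 3`. [folklore] -/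
private theorem X_one_eq_C_inv_mul (hp3 : 3 ≤ p) :
    (X 1 : MvPolynomial (Fin 2) K) = C (2⁻¹ : K) * (2 * X 1) := by
  rw [← mul_assoc, ← map_ofNat C 2, ← map_mul, inv_mul_cancel₀ (two_ne_zero_of_three_le K p hp3), C_1,
    one_mul]

omit hp in
/-- **`𝒟((z² + x^p)) = (z, x^p)`** in characteristic `p ≥ 3` (`∂_x f = 0`, `∂_z f = 2z` with `2`
a unit, and `x^p = f − z·z`). [cite: BierstoneGrigorievMilmanWlodarczyk2011, §3.5 after Def. 3.5.1] -/
theorem derivIdeal_span_tameWild (hp3 : 3 ≤ p) :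
    derivIdeal K (Ideal.span {(X 1 ^ 2 + X 0 ^ p : MvPolynomial (Fin 2) K)}) =
      Ideal.span {X 1, X 0 ^ p} := by
  rw [derivIdeal_span_singleton]
  have hrange : (Set.range fun i : Fin 2 => pderiv i (X 1 ^ 2 + X 0 ^ p : MvPolynomial (Fin 2) K)) =
      {0, 2 * X 1} := by
    ext g
    simp only [Set.mem_range, Set.mem_insert_iff, Set.mem_singleton_iff, Fin.exists_fin_two]
    rw [pderiv_zero_tameWild K p, pderiv_one_tameWild K p]
    constructor
    · rintro (h | h) <;> [exact Or.inl h.symm; exact Or.inr h.symm]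
    · rintro (h | h) <;> [exact Or.inl h.symm; exact Or.inr h.symm]
  rw [hrange]
  apply le_antisymm
  · refine sup_le ?_ ?_
    · rw [Ideal.span_singleton_le_iff_mem]
      have h1 : (X 1 ^ 2 : MvPolynomial (Fin 2) K) ∈ Ideal.span {X 1, X 0 ^ p} :=
        by rw [pow_two]; exact Ideal.mul_mem_left _ _ (Ideal.subset_span (by simp))
      exact Ideal.add_mem _ h1 (Ideal.subset_span (by simp))
    · rw [Ideal.span_le]
      rintro g (rfl | rfl)
      · exact Ideal.zero_mem _
      · exact Ideal.mul_mem_left _ _ (Ideal.subset_span (by simp))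
  · rw [Ideal.span_le]
    rintro g (rfl | rfl)
    · -- `z = 2⁻¹ · (2 z)`
      have h2z : (2 * X 1 : MvPolynomial (Fin 2) K) ∈
          Ideal.span {(X 1 ^ 2 + X 0 ^ p : MvPolynomial (Fin 2) K)} ⊔ Ideal.span {0, 2 * X 1} :=
        Ideal.mem_sup_right (Ideal.subset_span (by simp))
      have h := Ideal.mul_mem_left _ (C (2⁻¹ : K)) h2z
      rwa [← X_one_eq_C_inv_mul K p hp3] at h
    · -- `x^p = f - z · z`, with `z ∈ 𝒟` already
      have hz : (X 1 : MvPolynomial (Fin 2) K) ∈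
          Ideal.span {(X 1 ^ 2 + X 0 ^ p : MvPolynomial (Fin 2) K)} ⊔ Ideal.span {0, 2 * X 1} := by
        have h2z : (2 * X 1 : MvPolynomial (Fin 2) K) ∈
            Ideal.span {(X 1 ^ 2 + X 0 ^ p : MvPolynomial (Fin 2) K)} ⊔ Ideal.span {0, 2 * X 1} :=
          Ideal.mem_sup_right (Ideal.subset_span (by simp))
        have h := Ideal.mul_mem_left _ (C (2⁻¹ : K)) h2z
        rwa [← X_one_eq_C_inv_mul K p hp3] at h
      have hf : (X 1 ^ 2 + X 0 ^ p : MvPolynomial (Fin 2) K) ∈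
          Ideal.span {(X 1 ^ 2 + X 0 ^ p : MvPolynomial (Fin 2) K)} ⊔ Ideal.span {0, 2 * X 1} :=
        Ideal.mem_sup_left (Ideal.mem_span_singleton_self _)
      have hmem := Ideal.sub_mem _ hf (Ideal.mul_mem_left _ (X 1) hz)
      have e : (X 1 ^ 2 + X 0 ^ p : MvPolynomial (Fin 2) K) - X 1 * X 1 = X 0 ^ p := by ring
      rw [e] at hmem
      exact hmem

omit hp in
/-- **Tame at level 0**: `z ∈ 𝒟((f)) = MC((f), 2)` — an order-one element of Kollár's maximal
contact ideal (`2 < p`): the hyperplane `z = 0` is a hypersurface of maximal contact for `(f, 2)`,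
and `z ∉ 𝔪²`. [cite: Kollar2007, Def. 3.79, Thm. 3.80] -/
theorem X_one_mem_derivIdeal_span_tameWild (hp3 : 3 ≤ p) :
    (X 1 : MvPolynomial (Fin 2) K) ∈ derivIdeal K (Ideal.span {(X 1 ^ 2 + X 0 ^ p : MvPolynomial (Fin 2) K)}) ∧
      (X 1 : MvPolynomial (Fin 2) K) ∉ idealOfVars (Fin 2) K ^ 2 := by
  refine ⟨by rw [derivIdeal_span_tameWild K p hp3]; exact Ideal.subset_span (by simp), ?_⟩
  rw [X, monomial_mem_pow_idealOfVars_iff 2 _ one_ne_zero, Finsupp.degree_single]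
  omega

omit hp in
/-- **The coefficient ideal at level 0**: BGMW's `𝒞((f), 2) = (f) + 𝒟((f))²` (Def. 3.9.2 with
`μ = 2`: exponents `2!/2 = 1`, `2!/1 = 2`; marking `2! = 2`) equals `(z², x^p)` for `f = z² + x^p`,
`p ≥ 3`. [cite: BierstoneGrigorievMilmanWlodarczyk2011, Def. 3.9.2, Example 3.9.1] -/
theorem coeffIdealTwo_span_tameWild (hp3 : 3 ≤ p) :
    Ideal.span {(X 1 ^ 2 + X 0 ^ p : MvPolynomial (Fin 2) K)} ⊔
        derivIdeal K (Ideal.span {(X 1 ^ 2 + X 0 ^ p : MvPolynomial (Fin 2) K)}) ^ 2 =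
      Ideal.span {X 1 ^ 2, X 0 ^ p} := by
  rw [derivIdeal_span_tameWild K p hp3]
  apply le_antisymm
  · refine sup_le ?_ ?_
    · rw [Ideal.span_singleton_le_iff_mem]
      exact Ideal.add_mem _ (Ideal.subset_span (by simp)) (Ideal.subset_span (by simp))
    · rw [pow_two, Ideal.span_mul_span']
      refine Ideal.span_le.mpr ?_
      rintro g ⟨a, ha, b, hb, rfl⟩
      dsimp only
      rcases ha with rfl | rfl
      · -- `z · b` with `b ∈ {z, x^p}`
        rcases hb with rfl | rfl
        · rw [← pow_two]; exact Ideal.subset_span (by simp)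
        · exact Ideal.mul_mem_left _ _ (Ideal.subset_span (by simp))
      · exact Ideal.mul_mem_right _ _ (Ideal.subset_span (by simp))
  · rw [Ideal.span_le]
    rintro g (rfl | rfl)
    · -- `z² ∈ 𝒟²`
      refine Ideal.mem_sup_right ?_
      rw [pow_two, pow_two]
      exact Ideal.mul_mem_mul (Ideal.subset_span (by simp)) (Ideal.subset_span (by simp))
    · -- `x^p = f - z²`
      have hf : (X 1 ^ 2 + X 0 ^ p : MvPolynomial (Fin 2) K) ∈
          Ideal.span {(X 1 ^ 2 + X 0 ^ p : MvPolynomial (Fin 2) K)} ⊔ Ideal.span {X 1, X 0 ^ p} ^ 2 :=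
        Ideal.mem_sup_left (Ideal.mem_span_singleton_self _)
      have hz2 : (X 1 ^ 2 : MvPolynomial (Fin 2) K) ∈
          Ideal.span {(X 1 ^ 2 + X 0 ^ p : MvPolynomial (Fin 2) K)} ⊔ Ideal.span {X 1, X 0 ^ p} ^ 2 := by
        refine Ideal.mem_sup_right ?_
        rw [pow_two, pow_two]
        exact Ideal.mul_mem_mul (Ideal.subset_span (by simp)) (Ideal.subset_span (by simp))
      have hmem := Ideal.sub_mem _ hf hz2
      have e : (X 1 ^ 2 + X 0 ^ p : MvPolynomial (Fin 2) K) - X 1 ^ 2 = X 0 ^ p := by ring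
      rw [e] at hmem
      exact hmem

/-! ## Level 1: restriction to the maximal-contact hyperplane `z = 0` -/

omit hp [CharP K p] in
/-- **Restriction to `z = 0`**: under the `K`-algebra map `K[x, z] → K[x]`, `x ↦ x`, `z ↦ 0`
(restriction to the maximal-contact hyperplane `H = V(z) ≅ 𝔸¹`), the coefficient ideal
`(z², x^p)` maps onto **`(x^p)`** — the level-1 ideal of the induction, with marking `2! = 2`.
[cite: BierstoneGrigorievMilmanWlodarczyk2011, Def. 3.9.2, Example 3.9.1] -/
theorem map_killZ_coeffIdealTwo_span_tameWild :
    Ideal.map (aeval fun i : Fin 2 => if i = 0 then (X 0 : MvPolynomial (Fin 1) K) else 0)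
        (Ideal.span {(X 1 ^ 2 : MvPolynomial (Fin 2) K), X 0 ^ p}) =
      Ideal.span {(X 0 ^ p : MvPolynomial (Fin 1) K)} := by
  rw [Ideal.map_span, Set.image_pair, map_pow, map_pow, aeval_X, aeval_X]
  simp only [↓reduceIte, one_ne_zero]
  rw [zero_pow two_ne_zero, Ideal.span_insert_zero]

/-- **Wild at level 1, although tame at level 0 (`2 < p`).** The level-1 ideal `(x^p) ⊂ K[x]`
(marking `2`) has order `p > 2` at the origin — the marked ideal `((x^p), 2)` is NOT of maximal
order, so Kollár's 3.70 first reduces the order `p` of the ideal `(x^p)` itself, where: its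
initial form `x^p` is WILD (all Hasse–Schmidt derivatives `D^{(B)} x^p`, `|B| + 1 = p`, vanish),
and the derivation-based maximal contact ideal is blind: `𝒟^j((x^p)) ⊆ 𝔪²` for every `j`. So the
characteristic-zero induction, tame at level 0 for `(z² + x^p, 2)`, meets a wild point at level 1:
the orders at level 1 (`= p = deg f` here) are bounded by no function of the level-0 order `2`.
[cite: Kollar2007, Aside 3.57, 3.104 Step 2.2] [cite: BierstoneGrigorievMilmanWlodarczyk2011, Thm. 8.0.4, Lemma 8.0.3] -/
theorem nextLevel_wild_tameWild :
    (X 0 ^ p : MvPolynomial (Fin 1) K) ∈ idealOfVars (Fin 1) K ^ p ∧ 2 < p + 1 ∧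
      (∀ B : Fin 1 →₀ ℕ, B.degree + 1 = p →
        hasseDeriv K B (X 0 ^ p : MvPolynomial (Fin 1) K) = 0) ∧
      (∀ j : ℕ, derivIdealIter K j (Ideal.span {(X 0 ^ p : MvPolynomial (Fin 1) K)}) ≤
        idealOfVars (Fin 1) K ^ 2) := by
  have hp1 : 1 ≤ p := hp.out.one_lt.le
  refine ⟨?_, by have := hp.out.two_le; omega, ?_, ?_⟩
  · rw [X_pow_eq_monomial, monomial_mem_pow_idealOfVars_iff p _ one_ne_zero, Finsupp.degree_single]
  · exact (forall_hasseDeriv_X_pow_eq_zero_iff (R := K) p (0 : Fin 1) hp1).mpr (dvd_refl p)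
  · exact fun j => derivIdealIter_span_X_pow_le_idealOfVars_sq K p (0 : Fin 1) (le_refl p) j

end Example

/-! ## (v2, appended) The explicit formula IS the tree's `coeffIdeal` at `μ = 2` -/

section CoeffTwo

variable (R : Type*) {A : Type*} [CommSemiring R] [CommRing A] [Algebra R A]

/-- The marked sum of two marked ideals: `(I, a) + (J, b) = (I^b + J^a, a·b)` (BGMW §3.7 (1)),
first component. [cite: BierstoneGrigorievMilmanWlodarczyk2011, §3.7 (1)] -/
theorem markedSum_pair_fst (I J : Ideal A) (a b : ℕ) :
    (markedSum [(I, a), (J, b)]).1 = I ^ b + J ^ a := by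
  have h1 : (Finset.univ.erase (0 : Fin 2)) = {1} := by decide
  have h2 : (Finset.univ.erase (1 : Fin 2)) = {0} := by decide
  change ∑ i : Fin 2, ([(I, a), (J, b)].get i).1 ^
      (∏ j ∈ Finset.univ.erase i, ([(I, a), (J, b)].get j).2) = _
  rw [Fin.sum_univ_two, h1, h2, Finset.prod_singleton, Finset.prod_singleton]
  rfl

/-- … second component (the marking `a·b`). [cite: BierstoneGrigorievMilmanWlodarczyk2011, §3.7 (1)] -/
theorem markedSum_pair_snd (I J : Ideal A) (a b : ℕ) :
    (markedSum [(I, a), (J, b)]).2 = a * b := by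
  change ∏ j : Fin 2, ([(I, a), (J, b)].get j).2 = _
  rw [Fin.prod_univ_two]
  rfl

/-- **`𝒞(𝓘, 2) = (𝓘 + 𝒟(𝓘)², 2)`**: BGMW's coefficient ideal (Def. 3.9.2, tree `coeffIdeal`) at
marking `2` is `(𝒟⁰𝓘, 2) + (𝒟¹𝓘, 1) = (𝓘¹ + 𝒟(𝓘)², 2)` (Example 3.9.1).
[cite: BierstoneGrigorievMilmanWlodarczyk2011, Def. 3.9.2, Example 3.9.1] -/
theorem coeffIdeal_two (I : Ideal A) : coeffIdeal R I 2 = (I ⊔ derivIdeal R I ^ 2, 2) := by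
  have hL : (List.ofFn fun i : Fin 2 => (derivIdealIter R (↑i) I, 2 - (i : ℕ))) =
      [(I, 2), (derivIdeal R I, 1)] := by
    rw [List.ofFn_succ, List.ofFn_succ, List.ofFn_zero]
    rfl
  unfold coeffIdeal
  rw [hL]
  refine Prod.ext ?_ ?_
  · rw [markedSum_pair_fst, pow_one]
    rfl
  · rw [markedSum_pair_snd]

end CoeffTwo

section ExampleCoeff

variable (K : Type*) [Field K] (p : ℕ) [CharP K p]

/-- **The tree's coefficient ideal of `((z² + x^p), 2)` is `((z², x^p), 2)`** (`p ≥ 3`):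
`coeffIdeal K (f) 2 = ((f) + 𝒟((f))², 2) = ((z², x^p), 2)` — the explicit formula of
`coeffIdealTwo_span_tameWild` is BGMW's `𝒞((f), 2)` verbatim.
[cite: BierstoneGrigorievMilmanWlodarczyk2011, Def. 3.9.2, Example 3.9.1] -/
theorem coeffIdeal_span_tameWild (hp3 : 3 ≤ p) :
    coeffIdeal K (Ideal.span {(X 1 ^ 2 + X 0 ^ p : MvPolynomial (Fin 2) K)}) 2 =
      (Ideal.span {(X 1 ^ 2 : MvPolynomial (Fin 2) K), X 0 ^ p}, 2) := by
  rw [coeffIdeal_two, coeffIdealTwo_span_tameWild K p hp3]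

end ExampleCoeff

end Literature.AlgebraicGeometry.Resolution

end
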